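import Summits.QuantumFields.YangMills.Theses.QuantileBitPurity
import Summits.QuantumFields.YangMills.Theorems.QuantileBitPuritySectorTwistBound
import HarnessLib

/-!
# `QuantileBitPurity.HolonomyQuantileSubQuartic` ⟸ a PERIODIC-SECTOR core estimate (sorry-free reduction through the periodic-sector door)

Support module (`--supports` stmt-QuantumFields-23948; LINE g12-B of seat ym-idea-4; memo HOME `bc/g14-dw/SECTORS-translates.md`, skeleton
`bc/g14-dw/HolonomyQuantileSubQuartic_periodic_skeleton.lean`).  The crux asks that the slice-`0` core `{polDist ≤ β^{-γc}}` carry at most a fraction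
`q < 1` of the zero-flux thermal weight on the ring of `L` kernels, for some `γc ≤ 2/5`, on the window `L ≤ β^a`.  By the periodic-sector door
`TT.ringInsTrace_indicator_le_of_periodic_sector` (`Theorems/QuantileBitPuritySectorTwistBound.lean`: sector decomposition of the ring, the
Tomboulis–Yaffe ∕ Kanazawa twist inequality `Z_phys ≤ W_{+++}`, exact bookkeeping of the seven twisted sectors) it suffices to prove the SAME bound
INSIDE THE UNTWISTED SEAM SECTOR `z = (+,+,+)` with any fraction `q₀ < 1`: the crux then holds with `q = 1 − (1 − q₀)/8`.

★ `holonomyQuantileSubQuartic_of_periodic` : (periodic-sector core estimate) → `HolonomyQuantileSubQuartic` — the hypothesis is spelled out (no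
`def`); it is the ONE remaining stub of the skeleton (the translate estimate of PLAN-X1 v2 restricted to the untwisted sector, where no centre twist,
no centre-blind axis and no sign obstruction occur).  A CONDITIONAL result: it credits nothing by itself.
HONEST FRAMING: a reduction; no semiclassics/RG; nothing about infinite volume, the continuum limit or the Clay gap; YM mass gap NOT proved.
References: [cite: tHooft1979]; [cite: MontvayMunster1994, (3.145)]; [cite: Luscher1983, §2].
-/

set_option autoImplicit false

noncomputable section

open MeasureTheory Real
open Literature.MathematicalPhysics.QuantumLattice
open Literature.MathematicalPhysics.QuantumFieldTheory hiding SU2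
open Summit.QuantumFields.YangMills.Theorems
open Summit.QuantumFields.YangMills.Theorems.FemtoTransferGap
open Summit.QuantumFields.YangMills.Theorems.FemtoTransferGap.TT

namespace Summit.QuantumFields.YangMills.Theorems.QuantileBitPurity

/-- ★ **The crux from a periodic-sector core estimate.**  If for some `γc ∈ (0, 2/5]`, `q₀ < 1`, `a > 0` and thresholds, on the window
`L₀ ≤ L ≤ β^a` the slice-`0` core `{polDist ≤ β^{-γc}}` carries at most the fraction `q₀` of the weight of the UNTWISTED seam sector
(`TT.sectorWeight β (L−1) 0`), then `HolonomyQuantileSubQuartic` holds (with `q = 1 − (1 − q₀)/8`, thresholds `max β₀ 0`, `max L₀ 2`).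
[cite: tHooft1979] [cite: MontvayMunster1994, (3.145)] -/
theorem holonomyQuantileSubQuartic_of_periodic
    (h : ∃ γc : ℝ, 0 < γc ∧ γc ≤ 2 / 5 ∧ ∃ q₀ : ℝ, q₀ < 1 ∧ ∃ a : ℝ, 0 < a ∧ ∃ β₀ : ℝ, ∃ L₀ : ℕ, ∀ β : ℝ, β₀ ≤ β →
      ∀ (L : ℕ) [NeZero L], L₀ ≤ L → (L : ℝ) ≤ β ^ a →
        sectorWeight (L := L) β (L - 1) (fun _ => false)
            (fun Us _ => Set.indicator {U : GaugeConfig 3 L SU2 | FlatSheet.polDist U ≤ β ^ (-γc)} (fun _ => (1 : ℝ)) (Us 0)) ≤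
          q₀ * sectorWeight (L := L) β (L - 1) (fun _ => false) (fun _ _ => (1 : ℝ))) :
    Summit.QuantumFields.YangMills.Theses.QuantileBitPurity.HolonomyQuantileSubQuartic := by
  obtain ⟨γc, hγc0, hγc, q₀, hq₀, a, ha, β₀, L₀, hmain⟩ := h
  refine ⟨γc, hγc0, hγc, 1 - (1 - q₀) / 8, by linarith, a, ha, max β₀ 0, max L₀ 2, fun β hβ L _ hL hLa => ?_⟩
  have hβ0 : 0 ≤ β := le_trans (le_max_right _ _) hβ
  have hL2 : 2 ≤ L := le_trans (le_max_right _ _) hL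
  have hA : MeasurableSet {U : GaugeConfig 3 L SU2 | FlatSheet.polDist U ≤ β ^ (-γc)} :=
    measurableSet_le FlatSheet.measurable_polDist measurable_const
  have hq := hmain β (le_trans (le_max_left _ _) hβ) L (le_trans (le_max_left _ _) hL) hLa
  obtain ⟨m, hm⟩ : ∃ m : ℕ, L - 1 = m + 1 := ⟨L - 2, by omega⟩
  rw [hm] at hq
  have hdoor := ringInsTrace_indicator_le_of_periodic_sector (L := L) hβ0 m hA (by linarith : q₀ ≤ 1) hq
  have hT : physTrace L β L = physTraceSucc L β (m + 1) := by rw [physTrace, hm]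
  rw [hT, ← hm]
  rw [← hm] at hdoor
  exact hdoor

end Summit.QuantumFields.YangMills.Theorems.QuantileBitPurity

end
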